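import Literature.NumberTheory.BeurlingPrimes.LiAbel
import HarnessLib

/-!
# BDR 2023, Corollary 3.4 from Theorem 3.2, Hilberdink's theorem and the Broucke–Vindas `[0, 1/2]`-system

Topic `Literature/NumberTheory/BeurlingPrimes`. Everything in this file is PROVED: the named fact
`BrouckeDebruyneRevesz2023_cor34` ("Let `0 ≤ α < 1/2`. Then there exists an `[α, 1/2]`-Beurling system") of
`WellBehavedSystems.lean` follows from the named facts

* `BrouckeDebruyneRevesz2023_thm32` (prescribed real zeros/poles; used with `ℛ = {α}`, `𝒮 = ∅`, `δ = α/2`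
  for `0 < α < 1/2`),
* `Literature.Barriers.RiemannHypothesis.Hilberdink2005_thm1` (`max{α, β} ≥ 1/2`, for
  "`N_𝒫(x) − ax ≪ x^{1/2−ε}` cannot hold"),
* `BrouckeVindas2024_thm31` (the `[0, 1/2]`-system, for `α = 0`),

exactly as in the printed proof: "This follows from Theorem 3.2 with `ℛ = {α}`, `𝒮 = ∅` if `α > 0`. For
`α = 0`, we may take `M = 0` and `ℛ = 𝒮 = ∅` since `li(x)` is non-decreasing. Then the example … is
independent of `δ` which guarantees that the primes of this system are indeed `0`-well-behaved [here: the
Broucke–Vindas `[0,1/2]`-system of BV 2024, Thm. 3.1, which is that example, via `Π_𝒫 = Li + O(log log x)`,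
`LiAbel.lean`]. The fact that `N_𝒫(x) − ax ≪ x^{1/2−ε}` cannot hold for any `ε > 0` follows from
Hilberdink's result `max{α, β} ≥ 1/2`" [for `α = 0` BV's own `Ω_ε(x^{1/2−ε})` clause is used].

Main results: `isSystem_half_of_thm32` (`0 < α < 1/2`), `isSystem_zero_half_of_thm31` (`α = 0`),
`BrouckeDebruyneRevesz2023_cor34_of_thm32`.

## References
* [BrouckeDebruyneRevesz2023] F. Broucke, G. Debruyne, Sz. Gy. Révész, *Some examples of well-behaved Beurling
  number systems*, arXiv:2309.01567, Corollary 3.4 and its proof.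
* [BrouckeVindas2024] F. Broucke, J. Vindas, Math. Z. 307 (2024), Theorem 3.1.
* [Hilberdink2005] T. W. Hilberdink, J. Number Theory 112 (2005), Theorem 1.
-/

noncomputable section

open Filter Set
open scoped Topology

namespace Literature.NumberTheory.BeurlingPrimes

open Literature.Barriers.RiemannHypothesis

/-- **BDR Corollary 3.4 for `0 < α < 1/2`** from Theorem 3.2 (`ℛ = {α}`, `𝒮 = ∅`, `δ = α/2`) and Hilberdink's
theorem: the resulting system has `ψ_P(x) = x − x^α/α + O(x^{α/2})` and `N_P(x) = ax + O(x^{1/2} e^{c(log x)^{2/3}})`,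
hence is an `[α, 1/2]`-system. [cite: BrouckeDebruyneRevesz2023, proof of Corollary 3.4] -/
theorem isSystem_half_of_thm32 (h32 : BrouckeDebruyneRevesz2023_thm32) (hH : Hilberdink2005_thm1)
    {α : ℝ} (hα0 : 0 < α) (hα : α < 1 / 2) : ∃ P : BeurlingPrimes, P.IsSystem α (1 / 2) := by
  obtain ⟨P, ⟨C, hψ⟩, ⟨a, c, C₂, b, ha, hc, -, hN⟩, -⟩ :=
    h32 {α} ∅ (α / 2) (Finset.disjoint_empty_right _) (fun ρ hρ ↦ by
      rw [Finset.mem_singleton] at hρ; rw [hρ]; exact ⟨hα0, by linarith⟩) (fun ω hω ↦ by simp at hω)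
      (by linarith) (by linarith)
  -- the two expansions in usable form
  have hψ' : ∀ x : ℝ, 1 ≤ x → |P.chebyshevPsi x - x - (-1 / α) * x ^ α| ≤ C * x ^ (α / 2) := by
    intro x hx
    have h := hψ x hx
    simp only [Finset.sum_empty, Finset.sum_singleton, add_zero] at h
    have e : P.chebyshevPsi x - x - (-1 / α) * x ^ α = P.chebyshevPsi x - (x - x ^ α / α) := by ring
    rwa [e]
  have hN' : ∀ x : ℝ, 2 ≤ x → |(P.intCount x : ℝ) - a * x| ≤
      |C₂| * (x ^ (1 / 2 : ℝ) * Real.exp (c * Real.log x ^ (2 / 3 : ℝ))) := by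
    intro x hx
    have h := hN x hx
    simp only [Finset.filter_empty, Finset.sum_empty, add_zero] at h
    exact h.trans (mul_le_mul_of_nonneg_right (le_abs_self _) (by positivity))
  -- the prime clauses
  have hpu : ∀ ε : ℝ, 0 < ε → P.PrimeErrorLE (α + ε) := by
    intro ε hε
    refine BeurlingPrimes.PrimeErrorLE.of_le P ?_ (show α ≤ α + ε by linarith)
    refine P.primeErrorLE_of_forall_ge hα0.le (X := 1) (C := 1 / α + |C|) fun x hx ↦ ?_
    have h1 := hψ' x hx
    have hxα : 0 ≤ x ^ α := Real.rpow_nonneg (by linarith) _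
    have h2 : x ^ (α / 2) ≤ x ^ α := Real.rpow_le_rpow_of_exponent_le hx (by linarith)
    have h3 : |(-1 / α) * x ^ α| = 1 / α * x ^ α := by
      rw [abs_mul, abs_of_nonneg hxα, abs_div, abs_neg, abs_one, abs_of_pos hα0]
    have h4 : |P.chebyshevPsi x - x| ≤ 1 / α * x ^ α + C * x ^ (α / 2) := by
      have := abs_sub_abs_le_abs_sub (P.chebyshevPsi x - x) ((-1 / α) * x ^ α)
      linarith
    have h5 : C * x ^ (α / 2) ≤ |C| * x ^ α :=
      (mul_le_mul_of_nonneg_right (le_abs_self C) (Real.rpow_nonneg (by linarith) _)).trans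
        (mul_le_mul_of_nonneg_left h2 (abs_nonneg C))
    calc |P.chebyshevPsi x - x| ≤ 1 / α * x ^ α + |C| * x ^ α := by linarith
      _ = (1 / α + |C|) * x ^ α := by ring
  have hpl : ∀ ε : ℝ, 0 < ε → ¬ P.PrimeErrorLE (α - ε) := fun ε hε ↦
    P.not_primeErrorLE_of_mainTerm (b := -1 / α) (X := 1) (by
      rw [div_ne_zero_iff]; exact ⟨by norm_num, hα0.ne'⟩) (show α / 2 < α by linarith) hψ' hε
  refine ⟨P, hα0.le, by linarith, by norm_num, by norm_num, a, ha, fun ε hε ↦ ?_, fun ε hε ↦ ?_, hpu, hpl⟩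
  · -- `N_P(x) = ax + O(x^{1/2+ε})`
    obtain ⟨D, hD, hDle⟩ := sqrt_mul_exp_log_rpow_le hc hε
    refine P.intErrorLE_of_forall_ge (by linarith) (X := 2) (C := |C₂| * D) fun x hx ↦ ?_
    calc |(P.intCount x : ℝ) - a * x| ≤ |C₂| * (x ^ (1 / 2 : ℝ) * Real.exp (c * Real.log x ^ (2 / 3 : ℝ))) :=
          hN' x hx
      _ ≤ |C₂| * (D * x ^ (1 / 2 + ε)) := mul_le_mul_of_nonneg_left (hDle x (by linarith)) (abs_nonneg _)
      _ = |C₂| * D * x ^ (1 / 2 + ε) := by ring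
  · -- `N_P(x) − ax ≪ x^{1/2−ε}` cannot hold (Hilberdink)
    exact P.not_intErrorLE_of_hilberdink hH hα0.le hα ha hpu hpl hε

/-- **BDR Corollary 3.4 for `α = 0`**: the Broucke–Vindas system of BV 2024, Thm. 3.1 (`Π_P = Li + O(log log x)`,
`N_P = x + O(x^{1/2} e^{c (log x)^{2/3}})`, `N_P − x = Ω_ε(x^{1/2−ε})`) is a `[0, 1/2]`-system.
[cite: BrouckeDebruyneRevesz2023, proof of Corollary 3.4] -/
theorem isSystem_zero_half_of_thm31 (h31 : BrouckeVindas2024_thm31) : ∃ P : BeurlingPrimes, P.IsSystem 0 (1 / 2) := by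
  obtain ⟨P, ⟨C, hPi⟩, ⟨c, C₂, hc, hN⟩, hΩ⟩ := h31
  refine ⟨P, le_rfl, by norm_num, by norm_num, by norm_num, 1, one_pos, fun ε hε ↦ ?_, fun ε hε ↦ ?_,
    fun ε hε ↦ ?_, fun ε hε ↦ ?_⟩
  · -- `N_P(x) = x + O(x^{1/2+ε})`
    obtain ⟨D, hD, hDle⟩ := sqrt_mul_exp_log_rpow_le hc hε
    refine P.intErrorLE_of_forall_ge (by linarith) (X := 2) (C := |C₂| * D) fun x hx ↦ ?_
    rw [one_mul]
    calc |(P.intCount x : ℝ) - x| ≤ C₂ * (x ^ (1 / 2 : ℝ) * Real.exp (c * Real.log x ^ (2 / 3 : ℝ))) := hN x hx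
      _ ≤ |C₂| * (x ^ (1 / 2 : ℝ) * Real.exp (c * Real.log x ^ (2 / 3 : ℝ))) :=
          mul_le_mul_of_nonneg_right (le_abs_self _) (by positivity)
      _ ≤ |C₂| * (D * x ^ (1 / 2 + ε)) := mul_le_mul_of_nonneg_left (hDle x (by linarith)) (abs_nonneg _)
      _ = |C₂| * D * x ^ (1 / 2 + ε) := by ring
  · -- `Ω_ε(x^{1/2−ε})`
    obtain ⟨c₀, hc₀, hf⟩ := hΩ (ε / 2) (by linarith)
    refine P.not_intErrorLE_of_frequently hc₀ ?_ (show 1 / 2 - ε < 1 / 2 - ε / 2 by linarith)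
    simpa only [one_mul] using hf
  · -- the primes are `0`-well-behaved
    rw [zero_add]
    exact P.primeErrorLE_of_riemannPrimeCount_sub_Li hPi hε
  · -- and not better
    exact P.not_primeErrorLE_of_neg (by linarith)

/-- **BDR 2023, Corollary 3.4** from Theorem 3.2, Hilberdink 2005 Thm. 1 and BV 2024 Thm. 3.1.
[cite: BrouckeDebruyneRevesz2023, Corollary 3.4] -/
theorem BrouckeDebruyneRevesz2023_cor34_of_thm32 (h32 : BrouckeDebruyneRevesz2023_thm32)
    (hH : Hilberdink2005_thm1) (h31 : BrouckeVindas2024_thm31) : BrouckeDebruyneRevesz2023_cor34 := by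
  intro α hα0 hα
  rcases hα0.eq_or_lt with h0 | hpos
  · rw [← h0]
    exact isSystem_zero_half_of_thm31 h31
  · exact isSystem_half_of_thm32 h32 hH hpos hα

end Literature.NumberTheory.BeurlingPrimes
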